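import Summits.SmoothPoincare4.SmoothPoincare4.Theorems.VrlComponentsHBallSlice.Negative.LoadBearing
import Literature.Topology.FourManifolds.KnotGroupTorusKnotProofs
import Literature.Topology.FourManifolds.SliceKnots
import Mathlib.Data.Int.Order.Units

/-!
# `VrlComponentsHBallSlice` — negative-side support (2): the trefoil witness for the load-bearing analysis

Refuter lemmas (cdisprove seat, cycle 2, 2026-08-17) for crux item stmt-SmoothPoincare4-15874
(`VerlindeRLinks.VrlComponentsHBallSlice`).  The cycle-1 file `Negative/LoadBearing.lean` proved that
both hypotheses of the crux (`L.IsSurgery (𝓡 3) Y`, `IsSphereTwoProdCircleSum n Y`) and the coupling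
"number of components = number of `S² × S¹` summands" are load-bearing MODULO one input carried as
binders `(K : Knot) (hK : ¬ K.IsHomotopyBallSlice)`: a knot that is not slice in any homotopy
`4`-ball.  This file supplies that witness — the trefoil `T(2,3)` (`torusKnot 2 3`, an honest `Knot`:
`instTorusKnotFacts` is PROVED) — modulo three printed theorems, two of them already vendored as
named facts of the tree and the third stated verbatim as a binder:

* `isAlexanderPolynomial_torusKnot` (Rolfsen §7.D Ex. 5: `Δ_{T(p,q)}`; here `Δ_{T(2,3)} = t² - t + 1`,
  the closed form being the PROVED `torusKnotAlexander_two_three`);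
* `exists_eq_mul_invert_of_isTopologicallySlice` (Fox–Milnor 1966, Thm. 2, for flat discs: `Δ ≐ f f̄`;
  proved in the tree from its geometric half, `exists_eq_mul_invert_of_isTopologicallySlice_holds_of`);
* `hTop : ∀ K, K.IsHomotopyBallSlice → K.IsTopologicallySlice` (Freedman: the complement
  `Σ ∖ e(B̊⁴)` of a smooth ball in a closed homotopy `4`-sphere is a compact contractible topological
  `4`-manifold with boundary `S³`, hence HOMEOMORPHIC to `B⁴` — Freedman 1982, Thm. 1.6 with Brown's
  Schoenflies theorem — and a smooth proper disc with its tubular neighbourhood is carried to a flat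
  disc with a product neighbourhood; not in the tree, kept as an explicit hypothesis).

The algebra is unconditional and kernel-checked here: evaluating at `t = -1` (`LaurentPolynomial.eval₂`
at the unit `-1`, under which `f(t⁻¹) ↦ f(-1)` and units `±tᵏ ↦ ±1`) turns `Δ = u · f · f̄` into
`3 = ±m²`, impossible in `ℤ` (`torusKnotAlexander_two_three_ne_units_mul_mul_invert`).  Consequences:
`not_isTopologicallySlice_trefoil_of` (the trefoil is not topologically slice, modulo the two named
facts), `not_isHomotopyBallSlice_trefoil_of` (not H-ball-slice, modulo those and `hTop`), and the three
load-bearing statements of `LoadBearing.lean` with the knot binder DISCHARGED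
(`vrlComponentsHBallSlice_false_without_surgery_of_foxMilnor`,
`vrlComponentsHBallSlice_false_without_sphereSum_of_foxMilnor`,
`vrlComponentsHBallSlice_false_uncoupled_of_foxMilnor`); under SPC4 the Freedman input is not needed
(`not_isHomotopyBallSlice_trefoil_of_spc4`, via the PROVED FGMW lemma and the smooth Fox–Milnor fact).

References: R. H. Fox, J. W. Milnor, *Singularities of 2-spheres in 4-space and cobordism of knots*,
Osaka J. Math. 3 (1966) 257–267, Thm. 2; D. Rolfsen, *Knots and Links* (1976), §7.D Example 5, §8.E;
M. H. Freedman, *The topology of four-dimensional manifolds*, J. Differential Geom. 17 (1982) 357–453,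
Thm. 1.6; M. Freedman, R. Gompf, S. Morrison, K. Walker, Quantum Topol. 1 (2010) 171–208, §1.
-/

-- the prescribed namespace `Summit.<P>.<Sub>.…` duplicates `SmoothPoincare4` (P = Sub)
set_option linter.dupNamespace false

noncomputable section

namespace Summit.SmoothPoincare4.SmoothPoincare4.Theorems.VrlComponentsHBallSlice.Negative

open scoped Manifold ContDiff Topology LaurentPolynomial
open Set Function
open Literature.Topology.FourManifolds
open Summit.SmoothPoincare4.SmoothPoincare4.Theses.VerlindeRLinks

/-! ## §1 Algebra: `t² - t + 1` is not of Fox–Milnor form -/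

/-- Evaluation at `t = -1` does not see the substitution `t ↦ t⁻¹`:
`f(t⁻¹)|_{t=-1} = f(-1)` (checked on monomials `a tⁿ`, using `(-1)⁻¹ = -1` in `ℤˣ`). [folklore] -/
theorem eval₂_negOne_invert (f : ℤ[T;T⁻¹]) :
    LaurentPolynomial.eval₂ (RingHom.id ℤ) (-1) (LaurentPolynomial.invert f) =
      LaurentPolynomial.eval₂ (RingHom.id ℤ) (-1) f := by
  induction f using LaurentPolynomial.induction_on' with
  | add p q hp hq => simp only [map_add, hp, hq]
  | C_mul_T n a =>
    simp only [map_mul, LaurentPolynomial.invert_C, LaurentPolynomial.invert_T,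
      LaurentPolynomial.eval₂_C, LaurentPolynomial.eval₂_T, zpow_neg, Int.units_inv_eq_self]

/-- `Δ_{T(2,3)}(-1) = (-1)² - (-1) + 1 = 3` (the determinant of the trefoil), from the PROVED closed
form `torusKnotAlexander_two_three : Δ_{T(2,3)} = t² - t + 1`. [cite: Rolfsen1976, §7.D Example 5] -/
theorem eval₂_negOne_torusKnotAlexander_two_three :
    LaurentPolynomial.eval₂ (RingHom.id ℤ) (-1) (torusKnotAlexander 2 3) = 3 := by
  rw [torusKnotAlexander_two_three]
  norm_num [LaurentPolynomial.eval₂_T, zpow_ofNat, Units.val_pow_eq_pow_val]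

/-- **`t² - t + 1` is not of the form `u · f(t) · f(t⁻¹)`** in `ℤ[t, t⁻¹]` (`u` a unit): at `t = -1`
the right-hand side is `±m²` (`u ↦ ±1` since its value is a unit of `ℤ`, `f(t⁻¹) ↦ f(-1) = m`) while
the left-hand side is `3`, and `3 ≠ ±m²` in `ℤ`.  This is the Fox–Milnor obstruction for the trefoil
(equivalently: `|Δ(-1)| = 3` is not a square). [cite: FoxMilnor1966, §2 Thm. 2 and the example following it] -/
theorem torusKnotAlexander_two_three_ne_units_mul_mul_invert (f : ℤ[T;T⁻¹]) (u : ℤ[T;T⁻¹]ˣ) :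
    torusKnotAlexander 2 3 ≠ ↑u * f * LaurentPolynomial.invert f := by
  intro h
  have hu : LaurentPolynomial.eval₂ (RingHom.id ℤ) (-1) (↑u : ℤ[T;T⁻¹]) *
      LaurentPolynomial.eval₂ (RingHom.id ℤ) (-1) (↑u⁻¹ : ℤ[T;T⁻¹]) = 1 := by
    rw [← map_mul, Units.mul_inv, map_one]
  have h3 := congrArg (LaurentPolynomial.eval₂ (RingHom.id ℤ) (-1)) h
  rw [eval₂_negOne_torusKnotAlexander_two_three, map_mul, map_mul, eval₂_negOne_invert] at h3
  have hsq : 0 ≤ LaurentPolynomial.eval₂ (RingHom.id ℤ) (-1) f *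
      LaurentPolynomial.eval₂ (RingHom.id ℤ) (-1) f := mul_self_nonneg _
  rcases Int.eq_one_or_neg_one_of_mul_eq_one hu with h1 | h1 <;> rw [h1] at h3
  · have hlt : LaurentPolynomial.eval₂ (RingHom.id ℤ) (-1) f < 2 := by nlinarith
    have hgt : -2 < LaurentPolynomial.eval₂ (RingHom.id ℤ) (-1) f := by nlinarith
    generalize LaurentPolynomial.eval₂ (RingHom.id ℤ) (-1) f = m at *
    interval_cases m <;> omega
  · nlinarith

/-! ## §2 The trefoil is not slice in any homotopy ball (modulo named facts) -/

/-- **The trefoil `T(2,3)` is not topologically slice**, modulo the two named facts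
`isAlexanderPolynomial_torusKnot` (its Alexander polynomial, Rolfsen §7.D Ex. 5) and
`exists_eq_mul_invert_of_isTopologicallySlice` (Fox–Milnor for flat discs): `Δ = t² - t + 1` is not
`u f f̄`. [cite: FoxMilnor1966, §2 Thm. 2] [cite: Rolfsen1976, §7.D Example 5, §8.E] -/
theorem not_isTopologicallySlice_trefoil_of (hΔ : isAlexanderPolynomial_torusKnot)
    (hFM : exists_eq_mul_invert_of_isTopologicallySlice) :
    ¬ (torusKnot 2 3 le_rfl (by norm_num) (by decide)).IsTopologicallySlice := by
  intro hK
  obtain ⟨f, u, h⟩ := hFM _ hK (hΔ le_rfl (by norm_num) (by decide))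
  exact torusKnotAlexander_two_three_ne_units_mul_mul_invert f u h

/-- **The trefoil is not smoothly slice**, modulo `isAlexanderPolynomial_torusKnot` and the smooth
Fox–Milnor fact `exists_eq_mul_invert_of_isSmoothlySlice`. [cite: FoxMilnor1966, §2 Thm. 2] -/
theorem not_isSmoothlySlice_trefoil_of (hΔ : isAlexanderPolynomial_torusKnot)
    (hFM : exists_eq_mul_invert_of_isSmoothlySlice) :
    ¬ (torusKnot 2 3 le_rfl (by norm_num) (by decide)).IsSmoothlySlice := by
  intro hK
  obtain ⟨f, u, h⟩ := hFM _ hK (hΔ le_rfl (by norm_num) (by decide))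
  exact torusKnotAlexander_two_three_ne_units_mul_mul_invert f u h

/-- **The trefoil is not slice in any homotopy `4`-ball** — the missing input `H` of
`LoadBearing.lean`, discharged modulo `isAlexanderPolynomial_torusKnot`,
`exists_eq_mul_invert_of_isTopologicallySlice` and the Freedman input `hTop` ("H-ball-slice ⇒
topologically slice": the punctured homotopy sphere `Σ ∖ e(B̊⁴)` is a compact contractible topological
`4`-manifold bounded by `S³`, hence homeomorphic to `B⁴`, and the smooth disc with a tubular
neighbourhood becomes a flat disc with a product neighbourhood).
[cite: Freedman1982, Thm. 1.6] [cite: FoxMilnor1966, §2 Thm. 2] -/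
theorem not_isHomotopyBallSlice_trefoil_of (hΔ : isAlexanderPolynomial_torusKnot)
    (hFM : exists_eq_mul_invert_of_isTopologicallySlice)
    (hTop : ∀ K : Knot, K.IsHomotopyBallSlice → K.IsTopologicallySlice) :
    ¬ (torusKnot 2 3 le_rfl (by norm_num) (by decide)).IsHomotopyBallSlice :=
  fun h => not_isTopologicallySlice_trefoil_of hΔ hFM (hTop _ h)

/-- Under SPC4 the Freedman input is unnecessary: an H-ball-slice knot that is not smoothly slice
would already give an exotic `S⁴` (FGMW lemma, PROVED in the tree as
`Knot.exists_exotic_of_isHomotopyBallSlice_not_isSmoothlySlice_holds`), so SPC4, the Alexander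
polynomial of the trefoil and the SMOOTH Fox–Milnor fact suffice.
[cite: FreedmanGompfMorrisonWalker2010, §1] [cite: FoxMilnor1966, §2 Thm. 2] -/
theorem not_isHomotopyBallSlice_trefoil_of_spc4 (hS : _root_.SmoothPoincare4)
    (hΔ : isAlexanderPolynomial_torusKnot) (hFM : exists_eq_mul_invert_of_isSmoothlySlice) :
    ¬ (torusKnot 2 3 le_rfl (by norm_num) (by decide)).IsHomotopyBallSlice := by
  -- (`exists_not_isHomotopyBallSlice_of_spc4` of `LoadBearing.lean` returns SOME knot; here pointwise)
  intro hH
  obtain ⟨M, _, _, _, _, _, _, ⟨e⟩, hE⟩ :=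
    Knot.exists_exotic_of_isHomotopyBallSlice_not_isSmoothlySlice_holds
      ⟨_, hH, not_isSmoothlySlice_trefoil_of hΔ hFM⟩
  obtain ⟨d⟩ := hS M ‹_› ‹_› e
  exact hE.false d

/-! ## §3 The load-bearing statements of `LoadBearing.lean` with the knot binder discharged -/

/-- **LOAD-BEARING: `L.IsSurgery (𝓡 3) Y`** — the crux with the surgery hypothesis dropped is FALSE,
modulo the three printed inputs above (witness: the trefoil as the single component, `Y ≅ S² × S¹`).
[cite: FoxMilnor1966, §2 Thm. 2] [cite: Freedman1982, Thm. 1.6] -/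
theorem vrlComponentsHBallSlice_false_without_surgery_of_foxMilnor
    (hΔ : isAlexanderPolynomial_torusKnot) (hFM : exists_eq_mul_invert_of_isTopologicallySlice)
    (hTop : ∀ K : Knot, K.IsHomotopyBallSlice → K.IsTopologicallySlice) :
    ¬ ∀ (n : ℕ) (L : FramedLink (Fin n)) (Y : Type) [TopologicalSpace Y] [T2Space Y]
        [SecondCountableTopology Y] [ChartedSpace (EuclideanSpace ℝ (Fin 3)) Y]
        [IsManifold (𝓡 3) ∞ Y] [CompactSpace Y] [ConnectedSpace Y],
        IsSphereTwoProdCircleSum n Y → ∀ i : Fin n, (L.component i).IsHomotopyBallSlice :=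
  vrlComponentsHBallSlice_false_without_surgery_of _ (not_isHomotopyBallSlice_trefoil_of hΔ hFM hTop)

/-- **LOAD-BEARING: `IsSphereTwoProdCircleSum n Y`** — the crux with "the surgery is `#ⁿ(S² × S¹)`"
dropped is FALSE, modulo the same three inputs (witness: `0`-surgery on the trefoil).
[cite: FoxMilnor1966, §2 Thm. 2] [cite: Freedman1982, Thm. 1.6] -/
theorem vrlComponentsHBallSlice_false_without_sphereSum_of_foxMilnor
    (hΔ : isAlexanderPolynomial_torusKnot) (hFM : exists_eq_mul_invert_of_isTopologicallySlice)
    (hTop : ∀ K : Knot, K.IsHomotopyBallSlice → K.IsTopologicallySlice) :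
    ¬ ∀ (n : ℕ) (L : FramedLink (Fin n)) (Y : Type) [TopologicalSpace Y] [T2Space Y]
        [SecondCountableTopology Y] [ChartedSpace (EuclideanSpace ℝ (Fin 3)) Y]
        [IsManifold (𝓡 3) ∞ Y] [CompactSpace Y] [ConnectedSpace Y],
        L.IsSurgery (𝓡 3) Y → ∀ i : Fin n, (L.component i).IsHomotopyBallSlice :=
  vrlComponentsHBallSlice_false_without_sphereSum_of _
    (not_isHomotopyBallSlice_trefoil_of hΔ hFM hTop)

/-- **LOAD-BEARING: the coupling "`#components = #summands`"** — the uncoupled statement is FALSE at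
`(m, n) = (2, 0)`, modulo the slam-dunk fact `hSD` (as in `LoadBearing.lean`) and the same three
inputs (witness: `(trefoil, 0) ∪ (meridian, 0)`, a surgery diagram of `S³`).
[cite: GompfStipsicz1999, §5.1 Fig. 5.30] [cite: FoxMilnor1966, §2 Thm. 2] -/
theorem vrlComponentsHBallSlice_false_uncoupled_of_foxMilnor
    (hSD : ∀ (K : Knot) (r : ℤ), ∃ L : FramedLink (Fin 2), L.component 0 = K ∧
      L.IsSurgery (𝓡 3) (Metric.sphere (0 : EuclideanSpace ℝ (Fin 4)) 1))
    (hΔ : isAlexanderPolynomial_torusKnot) (hFM : exists_eq_mul_invert_of_isTopologicallySlice)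
    (hTop : ∀ K : Knot, K.IsHomotopyBallSlice → K.IsTopologicallySlice) :
    ¬ ∀ (m n : ℕ) (L : FramedLink (Fin m)) (Y : Type) [TopologicalSpace Y] [T2Space Y]
        [SecondCountableTopology Y] [ChartedSpace (EuclideanSpace ℝ (Fin 3)) Y]
        [IsManifold (𝓡 3) ∞ Y] [CompactSpace Y] [ConnectedSpace Y],
        IsSphereTwoProdCircleSum n Y → L.IsSurgery (𝓡 3) Y →
          ∀ i : Fin m, (L.component i).IsHomotopyBallSlice :=
  vrlComponentsHBallSlice_false_uncoupled_of hSD _ (not_isHomotopyBallSlice_trefoil_of hΔ hFM hTop)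

end Summit.SmoothPoincare4.SmoothPoincare4.Theorems.VrlComponentsHBallSlice.Negative

end
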